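import Summits.HodgeConjecture.HodgeConjecture.Theorems.Ring2WeilCoverageWeilGramLevel16
import HarnessLib

/-!
# Weil-type family coverage — THE COMPONENTS OF THE WEIL-TYPE `ℤ[ζ₁₆]`-FOURFOLDS, II: `K_d = ℚ(√−2)` (`s₂ = ζ² + ζ⁶ =
# ζ₈ + ζ₈³`): principal-type Gram determinant `32 = 2·4²`; `+32` for the `Φ`-positive ones on a `(2,2)` type (van
# Geemen's sign, part 92) — class `[2] = [1]`: SPLIT, row W4.2.1

research route conditional on HC_CM; not a corollary; Q11.4-sentence-2 already refuted in dim ≥ 3.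

Ring 2, WEIL-TYPE FAMILY-COVERAGE CENSUS (`HOME/WEIL-FAMILY-COVERAGE.md` `## b01`, blocks b01.46/b01.47), part 95 of the
`Ring2WeilCoverage*` series; continues part 94 (frame `θ^i`, `ξ = ζ³/Φ₁₆′(ζ)`, no THEOREM L (i) at `16`).

* §0 `s₂ = ζ² + ζ⁶` is skew with `s₂² = −2`; §1 the traces and the Gram datum: **`a = −(0,0,2,0 / 0,2,0,8 / 2,0,8,0 /
  0,8,0,28)`, `det a = 32`**; §2 every skew principal-type `ζ′` has `det a = ±32`, and **`= +32` when `ζ′` is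
  `Φ`-positive on an `s₂`-signature-`(2,2)` type** (part 92); class **`[32] = [1]`** in `ℚˣ/Nm(ℚ(√−2)ˣ)` (`32 = 2·4²`,
  `2 = Nm(√−2)`): SPLIT, row W4.2.1.

HONEST FRAMING as parts 82–94; `HC_CM` is used nowhere.  No `def`, no named fact, no `sorry`.  Certificates from
`work/py/gen16.py`, re-verified by `linear_combination`.

References: [cite: vanGeemen1994HodgeAV, Lemma 5.2 (2)–(4), 5.4 and (5.4.1)]; [cite: Shimura1998, §14.3 Prop. 4–5,
pp. 103–104]; census b01.46, b01.47 (seat-derived).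
-/

noncomputable section

open Polynomial NumberField Module
open scoped nonZeroDivisors

namespace Summit.HodgeConjecture.Ring2WeilCoverage.WeilGramLevel16SqrtNegTwo

open Literature.AlgebraicGeometry.VanGeemen1994 (weilField weilNormResidueGroup)
open Literature.AlgebraicGeometry.Motives (normUnitsSubgroup)
open Literature.NumberTheory.ComplexMultiplication
open Summit.HodgeConjecture.Ring2WeilCoverage.TraceGramDeterminant (trace_aeval_zeta_mul_inv)
open Summit.HodgeConjecture.Ring2WeilCoverage.WeilGramCMPoint
open Summit.HodgeConjecture.Ring2WeilCoverage.RealUnitNormHalfSystems (complexConj_eq_inv)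
open Summit.HodgeConjecture.Ring2WeilCoverage.CyclotomicPrincipalObstruction (complexConj_xi)
open Summit.HodgeConjecture.Ring2WeilCoverage.CyclotomicDifferent (isOfType_one_xi_top xi_ne_zero)
open Summit.HodgeConjecture.Ring2WeilCoverage.WeilGramSign (neg_one_pow_mul_det_realPart_pos)
open Literature.AlgebraicGeometry.Motives (CMType)
open Summit.HodgeConjecture.HodgeConjecture.Ring2.WeilCoverage (mk_eq_split_of_even mem_normUnitsSubgroup_of_sq_add_mul_sq)
open Summit.HodgeConjecture.HodgeConjecture.Ring2.Hypotheses (splitDiscriminantClass)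
open Summit.HodgeConjecture.Ring2WeilCoverage.WeilGramLevel16
open Summit.HodgeConjecture.Ring2WeilCoverage.WeilGramCMPoint (exists_real_eq_mul_of_skew exists_units_eq_mul_of_isOfType det_realPart_mul)
open Summit.HodgeConjecture.Ring2WeilCoverage.WeilGramLevel20 (aeval_poly₈)

variable {K : Type} [Field K] [NumberField K] {ζ : K}

/-! ### §0 `s₂ = ζ² + ζ⁶` -/

omit [NumberField K] in
/-- **`s₂² = −2`.** [folklore] -/
theorem sq_sqrtNegTwo (hζ : IsPrimitiveRoot ζ 16) : (ζ ^ 2 + ζ ^ 6) ^ 2 = -2 := by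
  linear_combination (2 + ζ ^ 4) * cyc_sixteen hζ

/-- **`s₂` is skew.** [folklore] -/
theorem complexConj_sqrtNegTwo [IsCMField K] (hζ : IsPrimitiveRoot ζ 16) :
    IsCMField.complexConj K (ζ ^ 2 + ζ ^ 6) = -(ζ ^ 2 + ζ ^ 6) := by
  rw [map_add, map_pow, map_pow, complexConj_eq_inv hζ, inv_pow_eq_pow hζ (show 2 + 14 = 16 by norm_num),
    inv_pow_eq_pow hζ (show 6 + 10 = 16 by norm_num)]
  linear_combination (ζ ^ 2 + ζ ^ 6) * cyc_sixteen hζ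

/-! ### §1 The principal-type form for `K_d = ℚ(√−2)`: `det = 32` -/

/-- `Tr(ζ′sθ^0) = 0` for `ζ′ = ξ = ζ³/Φ′(ζ)`, `s = √−2 = ζ² + ζ⁶`, `θ = ζ + ζ⁻¹` (Euler evaluation). research route conditional on HC_CM; not a corollary; Q11.4-sentence-2 already refuted in dim ≥ 3. [folklore] -/
theorem trace_xi_sqrtNegTwo_zero [IsCyclotomicExtension {16} ℚ K] (hζ : IsPrimitiveRoot ζ 16) :
    Algebra.trace ℚ K ((ζ ^ 3 * (aeval ζ (derivative (cyclotomic 16 ℚ)))⁻¹) * (ζ ^ 2 + ζ ^ 6)) = 0 := by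
  have hΦ := cyc_sixteen hζ
  rw [trace_of_key₀ hζ (C (0 : ℚ) + C (-1 : ℚ) * X + C (0 : ℚ) * X ^ 2 + C (0 : ℚ) * X ^ 3 + C (0 : ℚ) * X ^ 4 + C (1 : ℚ) * X ^ 5 +
      C (0 : ℚ) * X ^ 6 + C (0 : ℚ) * X ^ 7) (by compute_degree) (by
    rw [aeval_poly₈]
    push_cast
    linear_combination ((aeval ζ (derivative (cyclotomic 16 ℚ)))⁻¹ * (ζ)) * hΦ)]
  norm_num [coeff_X_pow, coeff_X, coeff_C, coeff_one]

/-- `Tr(ζ′sθ^1) = 0` for `ζ′ = ξ = ζ³/Φ′(ζ)`, `s = √−2 = ζ² + ζ⁶`, `θ = ζ + ζ⁻¹` (Euler evaluation). research route conditional on HC_CM; not a corollary; Q11.4-sentence-2 already refuted in dim ≥ 3. [folklore] -/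
theorem trace_xi_sqrtNegTwo_one [IsCyclotomicExtension {16} ℚ K] (hζ : IsPrimitiveRoot ζ 16) :
    Algebra.trace ℚ K ((ζ ^ 3 * (aeval ζ (derivative (cyclotomic 16 ℚ)))⁻¹) * (ζ ^ 2 + ζ ^ 6) * (ζ + ζ⁻¹)) = 0 := by
  have hΦ := cyc_sixteen hζ
  rw [trace_of_key₁ hζ (C (-1 : ℚ) + C (0 : ℚ) * X + C (-1 : ℚ) * X ^ 2 + C (0 : ℚ) * X ^ 3 + C (1 : ℚ) * X ^ 4 +
      C (0 : ℚ) * X ^ 5 + C (1 : ℚ) * X ^ 6 + C (0 : ℚ) * X ^ 7) (by compute_degree) (by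
    rw [aeval_poly₈]
    push_cast
    linear_combination ((aeval ζ (derivative (cyclotomic 16 ℚ)))⁻¹ * (ζ + ζ^3)) * hΦ)]
  norm_num [coeff_X_pow, coeff_X, coeff_C, coeff_one]

/-- `Tr(ζ′sθ^2) = 2` for `ζ′ = ξ = ζ³/Φ′(ζ)`, `s = √−2 = ζ² + ζ⁶`, `θ = ζ + ζ⁻¹` (Euler evaluation). research route conditional on HC_CM; not a corollary; Q11.4-sentence-2 already refuted in dim ≥ 3. [folklore] -/
theorem trace_xi_sqrtNegTwo_two [IsCyclotomicExtension {16} ℚ K] (hζ : IsPrimitiveRoot ζ 16) :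
    Algebra.trace ℚ K ((ζ ^ 3 * (aeval ζ (derivative (cyclotomic 16 ℚ)))⁻¹) * (ζ ^ 2 + ζ ^ 6) * (ζ + ζ⁻¹) ^ 2) = 2 := by
  have hΦ := cyc_sixteen hζ
  rw [trace_of_key hζ (C (0 : ℚ) + C (-2 : ℚ) * X + C (0 : ℚ) * X ^ 2 + C (0 : ℚ) * X ^ 3 + C (0 : ℚ) * X ^ 4 + C (2 : ℚ) * X ^ 5 +
      C (0 : ℚ) * X ^ 6 + C (2 : ℚ) * X ^ 7) (by compute_degree) (by
    rw [aeval_poly₈]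
    push_cast
    linear_combination ((aeval ζ (derivative (cyclotomic 16 ℚ)))⁻¹ * (2 * ζ^3 + ζ^5)) * hΦ)]
  norm_num [coeff_X_pow, coeff_X, coeff_C, coeff_one]

/-- `Tr(ζ′sθ^3) = 0` for `ζ′ = ξ = ζ³/Φ′(ζ)`, `s = √−2 = ζ² + ζ⁶`, `θ = ζ + ζ⁻¹` (Euler evaluation). research route conditional on HC_CM; not a corollary; Q11.4-sentence-2 already refuted in dim ≥ 3. [folklore] -/
theorem trace_xi_sqrtNegTwo_three [IsCyclotomicExtension {16} ℚ K] (hζ : IsPrimitiveRoot ζ 16) :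
    Algebra.trace ℚ K ((ζ ^ 3 * (aeval ζ (derivative (cyclotomic 16 ℚ)))⁻¹) * (ζ ^ 2 + ζ ^ 6) * (ζ + ζ⁻¹) ^ 3) = 0 := by
  have hΦ := cyc_sixteen hζ
  rw [trace_of_key hζ (C (-4 : ℚ) + C (0 : ℚ) * X + C (-2 : ℚ) * X ^ 2 + C (0 : ℚ) * X ^ 3 + C (2 : ℚ) * X ^ 4 +
      C (0 : ℚ) * X ^ 5 + C (4 : ℚ) * X ^ 6 + C (0 : ℚ) * X ^ 7) (by compute_degree) (by
    rw [aeval_poly₈]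
    push_cast
    linear_combination ((aeval ζ (derivative (cyclotomic 16 ℚ)))⁻¹ * (4 * ζ^3 + 3 * ζ^5 + ζ^7)) * hΦ)]
  norm_num [coeff_X_pow, coeff_X, coeff_C, coeff_one]

/-- `Tr(ζ′sθ^4) = 8` for `ζ′ = ξ = ζ³/Φ′(ζ)`, `s = √−2 = ζ² + ζ⁶`, `θ = ζ + ζ⁻¹` (Euler evaluation). research route conditional on HC_CM; not a corollary; Q11.4-sentence-2 already refuted in dim ≥ 3. [folklore] -/
theorem trace_xi_sqrtNegTwo_four [IsCyclotomicExtension {16} ℚ K] (hζ : IsPrimitiveRoot ζ 16) :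
    Algebra.trace ℚ K ((ζ ^ 3 * (aeval ζ (derivative (cyclotomic 16 ℚ)))⁻¹) * (ζ ^ 2 + ζ ^ 6) * (ζ + ζ⁻¹) ^ 4) = 8 := by
  have h16 : ζ ^ 16 = 1 := hζ.pow_eq_one
  have hΦ := cyc_sixteen hζ
  rw [trace_of_key hζ (C (0 : ℚ) + C (-6 : ℚ) * X + C (0 : ℚ) * X ^ 2 + C (0 : ℚ) * X ^ 3 + C (0 : ℚ) * X ^ 4 + C (6 : ℚ) * X ^ 5 +
      C (0 : ℚ) * X ^ 6 + C (8 : ℚ) * X ^ 7) (by compute_degree) (by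
    rw [aeval_poly₈]
    push_cast
    linear_combination ((aeval ζ (derivative (cyclotomic 16 ℚ)))⁻¹ * (ζ + 7 * ζ^5 + 4 * ζ^7)) * hΦ +
      ((aeval ζ (derivative (cyclotomic 16 ℚ)))⁻¹ * (ζ)) * h16)]
  norm_num [coeff_X_pow, coeff_X, coeff_C, coeff_one]

/-- `Tr(ζ′sθ^5) = 0` for `ζ′ = ξ = ζ³/Φ′(ζ)`, `s = √−2 = ζ² + ζ⁶`, `θ = ζ + ζ⁻¹` (Euler evaluation). research route conditional on HC_CM; not a corollary; Q11.4-sentence-2 already refuted in dim ≥ 3. [folklore] -/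
theorem trace_xi_sqrtNegTwo_five [IsCyclotomicExtension {16} ℚ K] (hζ : IsPrimitiveRoot ζ 16) :
    Algebra.trace ℚ K ((ζ ^ 3 * (aeval ζ (derivative (cyclotomic 16 ℚ)))⁻¹) * (ζ ^ 2 + ζ ^ 6) * (ζ + ζ⁻¹) ^ 5) = 0 := by
  have h16 : ζ ^ 16 = 1 := hζ.pow_eq_one
  have hΦ := cyc_sixteen hζ
  rw [trace_of_key hζ (C (-14 : ℚ) + C (0 : ℚ) * X + C (-6 : ℚ) * X ^ 2 + C (0 : ℚ) * X ^ 3 + C (6 : ℚ) * X ^ 4 +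
      C (0 : ℚ) * X ^ 5 + C (14 : ℚ) * X ^ 6 + C (0 : ℚ) * X ^ 7) (by compute_degree) (by
    rw [aeval_poly₈]
    push_cast
    linear_combination ((aeval ζ (derivative (cyclotomic 16 ℚ)))⁻¹ * (5 * ζ + ζ^3 + 15 * ζ^5 + 11 * ζ^7)) * hΦ +
      ((aeval ζ (derivative (cyclotomic 16 ℚ)))⁻¹ * (5 * ζ + ζ^3)) * h16)]
  norm_num [coeff_X_pow, coeff_X, coeff_C, coeff_one]

/-- `Tr(ζ′sθ^6) = 28` for `ζ′ = ξ = ζ³/Φ′(ζ)`, `s = √−2 = ζ² + ζ⁶`, `θ = ζ + ζ⁻¹` (Euler evaluation). research route conditional on HC_CM; not a corollary; Q11.4-sentence-2 already refuted in dim ≥ 3. [folklore] -/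
theorem trace_xi_sqrtNegTwo_six [IsCyclotomicExtension {16} ℚ K] (hζ : IsPrimitiveRoot ζ 16) :
    Algebra.trace ℚ K ((ζ ^ 3 * (aeval ζ (derivative (cyclotomic 16 ℚ)))⁻¹) * (ζ ^ 2 + ζ ^ 6) * (ζ + ζ⁻¹) ^ 6) = 28 := by
  have h16 : ζ ^ 16 = 1 := hζ.pow_eq_one
  have hΦ := cyc_sixteen hζ
  rw [trace_of_key hζ (C (0 : ℚ) + C (-20 : ℚ) * X + C (0 : ℚ) * X ^ 2 + C (0 : ℚ) * X ^ 3 + C (0 : ℚ) * X ^ 4 +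
      C (20 : ℚ) * X ^ 5 + C (0 : ℚ) * X ^ 6 + C (28 : ℚ) * X ^ 7) (by compute_degree) (by
    rw [aeval_poly₈]
    push_cast
    linear_combination ((aeval ζ (derivative (cyclotomic 16 ℚ)))⁻¹ * (16 * ζ + 6 * ζ^3 + 2 * ζ^5 + 26 * ζ^7)) * hΦ +
      ((aeval ζ (derivative (cyclotomic 16 ℚ)))⁻¹ * (16 * ζ + 6 * ζ^3 + ζ^5)) * h16)]
  norm_num [coeff_X_pow, coeff_X, coeff_C, coeff_one]

/-- **The Gram datum `a` of `(E_ζ′, s)` in the real frame `θ^i` (`i < 4`)** for `ζ′ = ξ = ζ³/Φ′(ζ)` (principal type (1)),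
`s = √−2 = ζ² + ζ⁶`: the integer Hankel matrix `(−Tr(ζ′sθ^{i+j}))ᵢⱼ` (and `b = 0`, part 82 `hb_eq_zero`).
research route conditional on HC_CM; not a corollary; Q11.4-sentence-2 already refuted in dim ≥ 3. [cite: vanGeemen1994HodgeAV, Lemma 5.2 (2)–(3)] -/
theorem realPart_xi_sqrtNegTwo [IsCyclotomicExtension {16} ℚ K] [IsCMField K] (hζ : IsPrimitiveRoot ζ 16)
    {x : Fin 4 → K} (hx : ∀ i, x i = (ζ + ζ⁻¹) ^ (i : ℕ)) {a : Matrix (Fin 4) (Fin 4) ℚ}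
    (ha : ∀ i j, a i j = Algebra.trace ℚ K ((ζ ^ 3 * (aeval ζ (derivative (cyclotomic 16 ℚ)))⁻¹) * x i * IsCMField.complexConj K ((ζ ^ 2 + ζ ^ 6) * x j))) :
    a = !![0, 0, -2, 0; 0, -2, 0, -8; -2, 0, -8, 0; 0, -8, 0, -28] := by
  rw [ha_eq (complexConj_sqrtNegTwo hζ) (complexConj_thetaFrame hζ hx) ha]
  ext i j
  simp only [Matrix.of_apply, hx, ← pow_add]
  fin_cases i <;> fin_cases j <;> simp [trace_xi_sqrtNegTwo_zero hζ, trace_xi_sqrtNegTwo_one hζ, trace_xi_sqrtNegTwo_two hζ, trace_xi_sqrtNegTwo_three hζ, trace_xi_sqrtNegTwo_four hζ, trace_xi_sqrtNegTwo_five hζ, trace_xi_sqrtNegTwo_six hζ]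

/-- **`det a = 32`** for `ζ′ = ξ = ζ³/Φ′(ζ)`, `s = √−2 = ζ² + ζ⁶` (frame `θ^i`). research route conditional on HC_CM; not a corollary; Q11.4-sentence-2 already refuted in dim ≥ 3. [cite: vanGeemen1994HodgeAV, Lemma 5.2 (3)] -/
theorem det_realPart_xi_sqrtNegTwo [IsCyclotomicExtension {16} ℚ K] [IsCMField K] (hζ : IsPrimitiveRoot ζ 16)
    {x : Fin 4 → K} (hx : ∀ i, x i = (ζ + ζ⁻¹) ^ (i : ℕ)) {a : Matrix (Fin 4) (Fin 4) ℚ}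
    (ha : ∀ i j, a i j = Algebra.trace ℚ K ((ζ ^ 3 * (aeval ζ (derivative (cyclotomic 16 ℚ)))⁻¹) * x i * IsCMField.complexConj K ((ζ ^ 2 + ζ ^ 6) * x j))) :
    a.det = 32 := by
  rw [realPart_xi_sqrtNegTwo hζ hx ha]
  simp [Matrix.det_succ_row_zero, Fin.sum_univ_succ, Fin.succAbove, Matrix.submatrix]
  norm_num

/-! ### §4 Principal-type parameters at the exceptional level: `det a = ±32`, and `= +32` for the `Φ`-positive ones -/

/-- **At level `16`, every skew `ζ′` of PRINCIPAL type on `ℤ[ζ₁₆]` has `det a = N(u)·32` for a unit `u` of `𝓞 K⁺`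
(`ζ′ = uξ`; `N(u) = ±1` — units of norm `−1` DO exist here, part 73), hence `det a = 32 ∨ det a = −32`.**
research route conditional on HC_CM; not a corollary; Q11.4-sentence-2 already refuted in dim ≥ 3. [cite: vanGeemen1994HodgeAV, Lemma 5.2 (3)] [cite: Shimura1998, §14.3 Prop. 5, p. 104] -/
theorem det_realPart_principal_sqrtNegTwo_or [IsCyclotomicExtension {16} ℚ K] [IsCMField K]
    (hζ : IsPrimitiveRoot ζ 16) {ζ' : K} (hζ' : IsCMField.complexConj K ζ' = -ζ')
    (hT : CMTypeLattice.IsOfType (1 : (FractionalIdeal (𝓞 K)⁰ K)ˣ) ζ' ⊤)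
    {x : Fin 4 → K} (hx : ∀ i, x i = (ζ + ζ⁻¹) ^ (i : ℕ)) {a : Matrix (Fin 4) (Fin 4) ℚ}
    (ha : ∀ i j, a i j = Algebra.trace ℚ K (ζ' * x i * IsCMField.complexConj K ((ζ ^ 2 + ζ ^ 6) * x j))) :
    a.det = 32 ∨ a.det = -32 := by
  obtain ⟨ωb, hωb⟩ := exists_basis_thetaPow hζ
  have hx' : ∀ i, x i = (ωb i : K) := fun i => (hx i).trans (hωb i).symm
  obtain ⟨γ₀, hγ⟩ := exists_real_eq_mul_of_skew (complexConj_xi_sixteen hζ) (complexConj_sqrtNegTwo hζ)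
  obtain ⟨u, hu⟩ := exists_units_eq_mul_of_isOfType (complexConj_xi_sixteen hζ) (xi_ne_zero hζ 3) hζ'
    (isOfType_one_xi_top hζ 3) hT
  have h8 := det_realPart_xi_sqrtNegTwo hζ hx (a := Matrix.of fun i j => Algebra.trace ℚ K
    ((ζ ^ 3 * (aeval ζ (derivative (cyclotomic 16 ℚ)))⁻¹) * x i * IsCMField.complexConj K ((ζ ^ 2 + ζ ^ 6) * x j)))
    (fun i j => rfl)
  have hmul := det_realPart_mul ωb (complexConj_sqrtNegTwo hζ) hx' hγ
    (β₀ := ((u : 𝓞 (maximalRealSubfield K)) : maximalRealSubfield K))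
    (a := Matrix.of fun i j => Algebra.trace ℚ K
      ((ζ ^ 3 * (aeval ζ (derivative (cyclotomic 16 ℚ)))⁻¹) * x i * IsCMField.complexConj K ((ζ ^ 2 + ζ ^ 6) * x j)))
    (a' := a) (fun i j => rfl) (fun i j => by rw [ha, hu])
  rw [h8] at hmul
  have hn := NumberField.Units.norm (maximalRealSubfield K) u
  rcases abs_eq (by norm_num : (0 : ℚ) ≤ 1) |>.mp hn with h1 | h1
  · left; rw [hmul, h1]; norm_num
  · right; rw [hmul, h1]; norm_num

open scoped Classical in
/-- **`det a = +32` for a `Φ`-POSITIVE principal-type `ζ′` on a CM type `Φ` of `s₂`-signature `(2, 2)`** — van Geemen's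
sign `0 < (−1)² det a` (part 92) excludes `−32`; such `ζ′` exist for every `Φ` (part 76 `exists_principal_sixteen`): the
principally polarised Weil-type `ℤ[ζ₁₆]`-fourfolds for `ℚ(√−2)` have `det H = 32`, class `[32] = [1]` — the SPLIT row W4.2.1 `= (2, ℚ(√−2), 1)`.
research route conditional on HC_CM; not a corollary; Q11.4-sentence-2 already refuted in dim ≥ 3. [cite: vanGeemen1994HodgeAV, Lemma 5.2 (3)–(4) and (5.4.1)] [cite: Shimura1998, §14.3 Prop. 4–5, pp. 103–104] -/
theorem det_realPart_principal_pos_sqrtNegTwo [IsCyclotomicExtension {16} ℚ K] [IsCMField K]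
    (hζ : IsPrimitiveRoot ζ 16) (Φ : CMType K)
    (hneg : (Finset.univ.filter fun φ : Φ.1 => (φ.1 ((ζ ^ 2 + ζ ^ 6))).im < 0).card = 2)
    (hposc : (Finset.univ.filter fun φ : Φ.1 => 0 < (φ.1 ((ζ ^ 2 + ζ ^ 6))).im).card = 2)
    {ζ' : K} (hζ' : IsCMField.complexConj K ζ' = -ζ') (hpos : ∀ φ : Φ.1, 0 < (φ.1 ζ').im)
    (hT : CMTypeLattice.IsOfType (1 : (FractionalIdeal (𝓞 K)⁰ K)ˣ) ζ' ⊤)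
    {x : Fin 4 → K} (hx : ∀ i, x i = (ζ + ζ⁻¹) ^ (i : ℕ)) {a : Matrix (Fin 4) (Fin 4) ℚ}
    (ha : ∀ i j, a i j = Algebra.trace ℚ K (ζ' * x i * IsCMField.complexConj K ((ζ ^ 2 + ζ ^ 6) * x j))) :
    a.det = 32 := by
  obtain ⟨ωb, hωb⟩ := exists_basis_thetaPow hζ
  have hx' : ∀ i, x i = (ωb i : K) := fun i => (hx i).trans (hωb i).symm
  have hs := complexConj_sqrtNegTwo hζ
  have hs0 : ((ζ ^ 2 + ζ ^ 6) : K) ≠ 0 := fun h => by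
    have h2 := sq_sqrtNegTwo hζ
    rw [h] at h2
    norm_num at h2
  have hζ'0 : ζ' ≠ 0 := by
    obtain ⟨φ, -⟩ := Finset.card_pos.mp (by rw [hposc]; norm_num :
      0 < (Finset.univ.filter fun φ : Φ.1 => 0 < (φ.1 ((ζ ^ 2 + ζ ^ 6))).im).card)
    intro h0
    have := hpos φ
    rw [h0, map_zero, Complex.zero_im] at this
    exact lt_irrefl _ this
  obtain ⟨γ₀, hγ⟩ := exists_real_eq_mul_of_skew hζ' hs
  have hsign := neg_one_pow_mul_det_realPart_pos Φ ωb hζ' hs hs0 hζ'0 hpos hneg hposc hx' hγ ha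
  rcases det_realPart_principal_sqrtNegTwo_or hζ hζ' hT hx ha with h | h
  · exact h
  · rw [h] at hsign; norm_num at hsign

/-- **`[32] = [1]`, the SPLIT class, in `ℚˣ/Nm(ℚ(√−2)ˣ)`** (`32 = 0² + 2·4²`): the SPLIT row W4.2.1 `= (2, ℚ(√−2), 1)`.
research route conditional on HC_CM; not a corollary; Q11.4-sentence-2 already refuted in dim ≥ 3. [cite: vanGeemen1994HodgeAV, 5.4 and (5.4.1)] -/
theorem mk0_det_principal_sqrtNegTwo :
    (QuotientGroup.mk (Units.mk0 (32 : ℚ) (by norm_num)) : weilNormResidueGroup 2) = splitDiscriminantClass 2 2 :=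
  mk_eq_split_of_even (by decide) _ (mem_normUnitsSubgroup_of_sq_add_mul_sq _ (0 : ℚ) (4 : ℚ) (by norm_num))

end Summit.HodgeConjecture.Ring2WeilCoverage.WeilGramLevel16SqrtNegTwo

end
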